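import Summits.QuantumFields.YangMills.Theorems.F4SubCurvatureDoorShortRootRigidityHermitianAngularContinuation
import Summits.QuantumFields.YangMills.Theorems.F4SubCurvatureDoorShortRootRigidityPlanarRigidity
import Summits.QuantumFields.YangMills.Theorems.F4SubCurvatureDoorShortRootRigidityPlanarFrameTimeHolomorphy
import Summits.QuantumFields.YangMills.Theorems.F4SubCurvatureDoorAngularContinuationCharts
import Mathlib
import HarnessLib

/-!
# Rung R4 «BOOST-POSITIVITY KILL», UNFOLDED — positivity at IMAGINARY ANGLES kills the modes `±3`

Free-hands work of width seat `ym-line-sfw-p2-w3` (g39, cell `ym-idea-1`).  Rung **R4 `BoostPositivityKill`** of the insurance sub-line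
g22-A «Hermitian slice» (`Cruxes/ShortRootRigidity/Lines/hermitian_slice_rungs.lean` fdd8f4dcefd5, owner ym-idea-3 g22/g23, critic idea-crit-4
g10 PASS tier B: «hardest rung R4 (new)») for the registered stub `:146 stub_oddModeRigidity` of crux ⟨stmt-QuantumFields-23035⟩
`F4SubCurvatureDoor.ShortRootRigidity`.

THE RUNG.  `k : ℝ² → ℂ` is `θ₂`-invariant and represented on `{t > 0}` by a complex planar Laplace–Fourier measure `μ ≥ 0` of aperture `1`
(`k(t,x) = ∫ e^{−tE}e^{ixp} dμ`, `μ{E < |p|} = 0`), and on every circle `k(polar r φ) = c₀(r) + c₁(r)e^{3iφ} + c₂(r)e^{−3iφ}`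
(`ThreeModeOnCircles`).  Then `k` is radial off `0`: `k (R y) = k y` for every linear isometry `R` and `y ≠ 0`.

THE SHORTCUT (why the «M–L new step» is S–M): no Vandermonde system, no boosted measures as objects, no Laplace–Fourier uniqueness, no
signed measures.  For `r > 0` the ANGULAR FUNCTION `H_r(z) = ∫ e^{−r cos z·E} e^{i r sin z·p} dμ` is holomorphic on the strip `|Re z| < π/2`
(dominated holomorphic parameter integral: the tube parameter of the chart point is `r cos(Re z) e^{−|Im z|} > 0`), restricts to
`φ ↦ k(polar r φ)` on the real segment, hence (identity theorem, ✓`eqOn_of_eq_on_real`) `H_r(z) = c₀ + c₁e^{3iz} + c₂e^{−3iz}` on the strip.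
AT THE IMAGINARY ANGLE `z = iσ`: `H_r(iσ) = ∫ e^{−r(E ch σ + p sh σ)} dμ` is a NONNEGATIVE REAL (it is the pairing of the Lorentz-BOOSTED
measure `μ_σ` with `e^{−rE}`, read at `x = 0` — positivity of the boost in one number), while the time reflection
(`θ₂(polar r φ) = polar r (π − φ)`, read at `φ = 0, π`) gives `c₂ = −c₁`.  So `c₀(r) − c₁(r)·(e^{3σ} − e^{−3σ}) ∈ ℝ_{≥ 0}` for EVERY
`σ ∈ ℝ`; since `e^{3σ} − e^{−3σ} = 2 sinh 3σ ≥ 6σ` is unbounded in both directions, `c₁(r) = 0 = c₂(r)`, i.e. `k(polar r ·) ≡ c₀(r)`.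
Only `θ₂`-invariance, the representation, the aperture and the three-mode form are used — NOT the budget, NOT `θ_hex`, NOT continuity.

`boostPositivityKill_unfolded` states the rung with `InHermitianPlanarClass` / `IsHermitianPlanarLF` / `HasAperture` / `ThreeModeOnCircles`
unfolded (letters of the rungs file: `mk2` of `…PlanarFrameTimeHolomorphyRegistered`, `polar` of `…AngularType`); the by-name
`boostPositivityKill_holds : BoostPositivityKill` is its one-line specialisation over the vocabulary file of w4 g25 (filed separately).
Mathlib + tree only; no `sorry`; no definitions.

HONEST LABEL: ONE rung of an unregistered INSURANCE sub-line for `:146`; H1, H3, H4, `:146`, ⟨23035⟩, ⟨23125⟩, R2d and the Yang–Mills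
mass gap are OPEN; no summit is proved by a line.
-/

noncomputable section

namespace Summit.QuantumFields.YangMills.Theorems.F4SubCurvatureDoorHermitianBoost

open MeasureTheory Complex Filter Set Metric Function
open scoped Topology Real
open Literature.MathematicalPhysics.QuantumLattice (timeReflection timeReflection_apply)
open Summit.QuantumFields.YangMills.Theorems.F4SubCurvatureDoorSliceDensityRegistered (E2)
open Summit.QuantumFields.YangMills.Cruxes.ShortRootRigidity.AngularType (mk2 polar)
open Summit.QuantumFields.YangMills.Cruxes.ShortRootRigidity.AngularType.AngularChartA
  (mk2_zero mk2_one eqOn_of_eq_on_real isPreconnected_vstrip)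
open Summit.QuantumFields.YangMills.Theorems.F4SubCurvatureDoorPlanarRigidityByName (exists_polar)
open Summit.QuantumFields.YangMills.Theorems.F4SubCurvatureDoorHermitianTube (norm_hKer_le_cone ae_abs_le_of_aperture_one)
open Summit.QuantumFields.YangMills.Theorems.F4SubCurvatureDoorHermitianAngular (chart_re_sub_abs_im')

/-! ## The time reflection on circles and the relation `c₂ = −c₁` -/

/-- `θ₂ (polar r φ) = polar r (π − φ)`. -/
theorem timeReflection_polar (r φ : ℝ) : timeReflection 2 (polar r φ) = polar r (π - φ) := by
  ext i
  fin_cases i <;> simp [polar, mk2, timeReflection_apply, Real.cos_pi_sub, Real.sin_pi_sub]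

/-- `e^{3πi} = −1`. -/
theorem exp_three_pi_mul_I : Complex.exp (3 * (Real.pi : ℂ) * Complex.I) = -1 := by
  rw [show (3 : ℂ) * (Real.pi : ℂ) * Complex.I = Real.pi * Complex.I + 2 * Real.pi * Complex.I by ring, Complex.exp_add,
    Complex.exp_pi_mul_I, Complex.exp_two_pi_mul_I, mul_one]

/-- **`θ₂` gives `c₁ + c₂ = 0`**: compare the three-mode form at `φ = 0` and at `φ = π = π − 0`. -/
theorem coeff_add_eq_zero {k : E2 → ℂ} (hT : ∀ y, k (timeReflection 2 y) = k y) {r : ℝ} {c₀ c₁ c₂ : ℂ}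
    (h : ∀ φ : ℝ, k (polar r φ) = c₀ + c₁ * Complex.exp (3 * (φ : ℂ) * Complex.I) + c₂ * Complex.exp (-(3 * (φ : ℂ) * Complex.I))) :
    c₁ + c₂ = 0 := by
  have h0 := h 0
  have hπ := h Real.pi
  have hrefl : k (polar r Real.pi) = k (polar r 0) := by
    rw [← hT (polar r 0), timeReflection_polar, sub_zero]
  simp only [Complex.ofReal_zero, mul_zero, zero_mul, neg_zero, Complex.exp_zero, mul_one] at h0
  rw [exp_three_pi_mul_I, Complex.exp_neg, exp_three_pi_mul_I, hrefl, h0] at hπ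
  have : c₁ + c₂ = -(c₁ + c₂) := by
    have e : ((-1 : ℂ))⁻¹ = -1 := by norm_num
    rw [e] at hπ
    linear_combination hπ
  linear_combination this / 2

/-! ## The angular kernel at radius `r`: `z ↦ e^{−r cos z·E} e^{i r sin z·p}` -/

/-- The angular kernel at a REAL angle, in the letters of `IsHermitianPlanarLF`. -/
theorem angularKer_ofReal (r φ E p : ℝ) :
    Complex.exp (-((r : ℂ) * Complex.cos (φ : ℂ) * (E : ℂ))) * Complex.exp ((r : ℂ) * Complex.sin (φ : ℂ) * (p : ℂ) * Complex.I)
      = ((Real.exp (-(E * (r * Real.cos φ))) : ℝ) : ℂ) * Complex.exp (((p * (r * Real.sin φ) : ℝ) : ℂ) * Complex.I) := by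
  rw [Complex.ofReal_exp]
  push_cast
  ring_nf

/-- **The angular kernel at an IMAGINARY angle is a positive real**: `e^{−r cos(iσ)E} e^{i r sin(iσ) p} = e^{−r(E ch σ + p sh σ)}`. -/
theorem angularKer_imag (r σ E p : ℝ) :
    Complex.exp (-((r : ℂ) * Complex.cos ((σ : ℂ) * Complex.I) * (E : ℂ))) *
        Complex.exp ((r : ℂ) * Complex.sin ((σ : ℂ) * Complex.I) * (p : ℂ) * Complex.I)
      = ((Real.exp (-(r * (Real.cosh σ * E + Real.sinh σ * p))) : ℝ) : ℂ) := by
  rw [Complex.cos_mul_I, Complex.sin_mul_I, ← Complex.exp_add, Complex.ofReal_exp]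
  congr 1
  have hI : Complex.I * Complex.I = -1 := Complex.I_mul_I
  push_cast
  linear_combination ((r : ℂ) * Complex.sinh (σ : ℂ) * (p : ℂ)) * hI

/-- `e^{3i·(iσ)} = e^{−3σ}` and `e^{−3i·(iσ)} = e^{3σ}`. -/
theorem exp_three_mul_imag (σ : ℝ) :
    Complex.exp (3 * ((σ : ℂ) * Complex.I) * Complex.I) = ((Real.exp (-(3 * σ)) : ℝ) : ℂ) ∧
      Complex.exp (-(3 * ((σ : ℂ) * Complex.I) * Complex.I)) = ((Real.exp (3 * σ) : ℝ) : ℂ) := by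
  have hI : Complex.I * Complex.I = -1 := Complex.I_mul_I
  have e : (3 : ℂ) * ((σ : ℂ) * Complex.I) * Complex.I = -(3 * (σ : ℂ)) := by
    linear_combination (3 * (σ : ℂ)) * hI
  rw [e, neg_neg, Complex.ofReal_exp, Complex.ofReal_exp]
  constructor
  · push_cast; ring_nf
  · push_cast; ring_nf

/-! ## Holomorphy of the angular function on the strip `|Re z| < π/2` -/

/-- **The angular function `H_r(z) = ∫ e^{−r cos z·E} e^{i r sin z·p} dμ` is holomorphic on the strip `|Re z| < π/2`** for a cone-supported
measure with `e^{−tE} ∈ L¹(μ)` for all `t > 0` (dominated holomorphic parameter integral; near `z₀` the dominator is `e^{−mE}` with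
`m = r cos(|Re z₀| + R) e^{−|Im z₀| − R}`, `2R = π/2 − |Re z₀|`). -/
theorem differentiableOn_angular (μ : Measure (ℝ × ℝ))
    (hInt : ∀ t : ℝ, 0 < t → Integrable (fun w : ℝ × ℝ => Real.exp (-(t * w.1))) μ)
    (hap : μ {w : ℝ × ℝ | w.1 < 1 * |w.2|} = 0) {r : ℝ} (hr : 0 < r) :
    DifferentiableOn ℂ (fun z : ℂ => ∫ w : ℝ × ℝ,
        Complex.exp (-((r : ℂ) * Complex.cos z * (w.1 : ℂ))) * Complex.exp ((r : ℂ) * Complex.sin z * (w.2 : ℂ) * Complex.I) ∂μ)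
      {z : ℂ | -(π / 2) < z.re ∧ z.re < π / 2} := by
  have haeC : ∀ᵐ w ∂μ, |w.2| ≤ w.1 := ae_abs_le_of_aperture_one hap
  have hae0 : ∀ᵐ w ∂μ, 0 ≤ w.1 := by
    filter_upwards [haeC] with w hw using (abs_nonneg _).trans hw
  have hKc : ∀ z : ℂ, Continuous fun w : ℝ × ℝ =>
      Complex.exp (-((r : ℂ) * Complex.cos z * (w.1 : ℂ))) * Complex.exp ((r : ℂ) * Complex.sin z * (w.2 : ℂ) * Complex.I) :=
    fun z => by fun_prop
  have hKd : ∀ w : ℝ × ℝ, Differentiable ℂ fun z : ℂ =>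
      Complex.exp (-((r : ℂ) * Complex.cos z * (w.1 : ℂ))) * Complex.exp ((r : ℂ) * Complex.sin z * (w.2 : ℂ) * Complex.I) :=
    fun w => by fun_prop
  refine Literature.Analysis.Complex.differentiableOn_integral_of_dominated (fun z _ => (hKc z).aestronglyMeasurable)
    (Eventually.of_forall fun w => (hKd w).differentiableOn) ?_
  intro z₀ hz₀
  obtain ⟨hz₀l, hz₀r⟩ := hz₀
  have habs₀ : |z₀.re| < π / 2 := abs_lt.2 ⟨by linarith, by linarith⟩
  set R : ℝ := (π / 2 - |z₀.re|) / 2 with hR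
  have hRpos : 0 < R := by rw [hR]; linarith
  have hsum : |z₀.re| + R < π / 2 := by rw [hR]; linarith
  -- the lower bound of the tube parameter on the ball
  set c : ℝ := Real.cos (|z₀.re| + R) with hc
  have hcpos : 0 < c := Real.cos_pos_of_mem_Ioo ⟨by linarith [abs_nonneg z₀.re], hsum⟩
  set m : ℝ := r * c * Real.exp (-(|z₀.im| + R)) with hm
  have hmpos : 0 < m := by positivity
  have hball : ∀ z : ℂ, z ∈ ball z₀ R → |z.re - z₀.re| < R ∧ |z.im - z₀.im| < R := by
    intro z hz
    rw [mem_ball, dist_eq_norm] at hz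
    exact ⟨lt_of_le_of_lt (by simpa using Complex.abs_re_le_norm (z - z₀)) hz,
      lt_of_le_of_lt (by simpa using Complex.abs_im_le_norm (z - z₀)) hz⟩
  have hparam : ∀ z : ℂ, z ∈ ball z₀ R → c ≤ Real.cos z.re ∧ m ≤ r * Real.cos z.re * Real.exp (-|z.im|) := by
    intro z hz
    obtain ⟨h1, h2⟩ := hball z hz
    have hre : |z.re| ≤ |z₀.re| + R := by
      have := abs_sub_abs_le_abs_sub z.re z₀.re
      linarith
    have him : |z.im| ≤ |z₀.im| + R := by
      have := abs_sub_abs_le_abs_sub z.im z₀.im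
      linarith
    have hcos : c ≤ Real.cos z.re := by
      rw [← Real.cos_abs z.re, hc]
      exact Real.cos_le_cos_of_nonneg_of_le_pi (abs_nonneg _) (by linarith [Real.pi_pos]) hre
    have hexp : Real.exp (-(|z₀.im| + R)) ≤ Real.exp (-|z.im|) := Real.exp_le_exp.2 (by linarith)
    refine ⟨hcos, ?_⟩
    rw [hm]
    exact mul_le_mul (mul_le_mul_of_nonneg_left hcos hr.le) hexp (Real.exp_pos _).le (mul_nonneg hr.le (hcpos.le.trans hcos))
  refine ⟨R, hRpos, ?_, fun w => Real.exp (-(m * w.1)), hInt m hmpos, ?_⟩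
  · -- the ball stays in the strip
    intro z hz
    obtain ⟨h1, -⟩ := hball z hz
    have : |z.re| < π / 2 := by
      have := abs_sub_abs_le_abs_sub z.re z₀.re
      linarith
    exact ⟨by linarith [neg_abs_le z.re, (abs_lt.1 this).1], (abs_lt.1 this).2⟩
  · -- domination
    filter_upwards [hae0, haeC] with w hw0 hwC z hz
    obtain ⟨hcos, hmle⟩ := hparam z hz
    have hrc : 0 ≤ r * Real.cos z.re := by nlinarith [hcpos, hr]
    refine (norm_hKer_le_cone (ζ := (r : ℂ) * Complex.cos z) (β := (r : ℂ) * Complex.sin z) hwC).trans ?_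
    rw [chart_re_sub_abs_im' z hrc]
    exact Real.exp_le_exp.2 (by nlinarith)

/-! ## The coefficient algebra -/

/-- **Unbounded positivity kills the coefficient**: if `c₀ − c₁(e^{3σ} − e^{−3σ})` is a nonnegative real for every real `σ`, then `c₁ = 0`. -/
theorem coeff_eq_zero_of_nonneg (c₀ c₁ : ℂ) (P : ℝ → ℝ) (hP : ∀ σ, 0 ≤ P σ)
    (h : ∀ σ : ℝ, c₀ + c₁ * (((Real.exp (-(3 * σ)) : ℝ) : ℂ) - ((Real.exp (3 * σ) : ℝ) : ℂ)) = ((P σ : ℝ) : ℂ)) :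
    c₁ = 0 := by
  -- `σ = 0`: `c₀ = P 0`, a nonnegative real
  have h0 := h 0
  simp only [mul_zero, neg_zero, sub_self, mul_zero, add_zero] at h0
  have hc0re : c₀.re = P 0 := by rw [h0, Complex.ofReal_re]
  have hc0im : c₀.im = 0 := by rw [h0, Complex.ofReal_im]
  -- the real and imaginary parts of the identity
  have hparts : ∀ σ : ℝ, c₀.re - c₁.re * (Real.exp (3 * σ) - Real.exp (-(3 * σ))) = P σ ∧
      c₁.im * (Real.exp (3 * σ) - Real.exp (-(3 * σ))) = 0 := by
    intro σ
    have hσ := h σ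
    have hre := congrArg Complex.re hσ
    have him := congrArg Complex.im hσ
    simp only [Complex.add_re, Complex.mul_re, Complex.sub_re, Complex.ofReal_re, Complex.sub_im, Complex.ofReal_im,
      sub_zero, mul_zero, Complex.add_im, Complex.mul_im] at hre him
    rw [hc0im, zero_add] at him
    constructor
    · linarith
    · linarith
  -- imaginary part: `σ = 1`
  have hd1 : 0 < Real.exp (3 * (1 : ℝ)) - Real.exp (-(3 * (1 : ℝ))) := by
    have := Real.exp_lt_exp.2 (show -(3 * (1 : ℝ)) < 3 * 1 by norm_num)
    linarith
  have hc1im : c₁.im = 0 := by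
    have := (hparts 1).2
    rcases mul_eq_zero.1 this with h' | h'
    · exact h'
    · linarith
  -- real part: unbounded `d(σ) = e^{3σ} − e^{−3σ} ≥ 6σ`
  have hd : ∀ σ : ℝ, 0 ≤ σ → 6 * σ ≤ Real.exp (3 * σ) - Real.exp (-(3 * σ)) := by
    intro σ hσ
    have hs : 3 * σ ≤ Real.sinh (3 * σ) := Real.self_le_sinh_iff.2 (by linarith)
    rw [Real.sinh_eq] at hs
    linarith
  have hc1re : c₁.re = 0 := by
    by_contra hne
    have hpos : 0 < |c₁.re| := abs_pos.2 hne
    have hP0 : 0 ≤ c₀.re := by rw [hc0re]; exact hP 0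
    set σ₀ : ℝ := (c₀.re + 1) / (6 * |c₁.re|) with hσ₀
    have hσ₀pos : 0 ≤ σ₀ := by rw [hσ₀]; exact div_nonneg (by linarith) (by positivity)
    have hdσ := hd σ₀ hσ₀pos
    have h6 : 6 * σ₀ * |c₁.re| = c₀.re + 1 := by rw [hσ₀]; field_simp
    -- the identity at `σ₀` and at `−σ₀`
    have hplus := (hparts σ₀).1
    have hminus := (hparts (-σ₀)).1
    rw [show 3 * -σ₀ = -(3 * σ₀) by ring, neg_neg] at hminus
    have hPp := hP σ₀
    have hPm := hP (-σ₀)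
    -- `|c₁.re| · d ≤ c₀.re`
    have hbound : |c₁.re| * (Real.exp (3 * σ₀) - Real.exp (-(3 * σ₀))) ≤ c₀.re := by
      rcases le_or_gt 0 c₁.re with hsg | hsg
      · rw [abs_of_nonneg hsg]; linarith
      · rw [abs_of_neg hsg]; linarith
    have : c₀.re + 1 ≤ c₀.re :=
      calc c₀.re + 1 = 6 * σ₀ * |c₁.re| := h6.symm
        _ ≤ (Real.exp (3 * σ₀) - Real.exp (-(3 * σ₀))) * |c₁.re| := mul_le_mul_of_nonneg_right hdσ hpos.le
        _ = |c₁.re| * (Real.exp (3 * σ₀) - Real.exp (-(3 * σ₀))) := mul_comm _ _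
        _ ≤ c₀.re := hbound
    linarith
  exact Complex.ext (by simpa using hc1re) (by simpa using hc1im)

/-! ## The rung, unfolded -/

open Summit.QuantumFields.YangMills.Theorems.F4SubCurvatureDoorPlanarFrameTimeHolomorphyRegistered renaming mk2 → mk2'

/-- **The three-mode coefficients vanish on every circle** (the heart of R4). -/
theorem threeMode_coeff_eq_zero (k : E2 → ℂ) (μ : Measure (ℝ × ℝ))
    (hT : ∀ y, k (timeReflection 2 y) = k y)
    (hLF : ∀ t : ℝ, 0 < t → Integrable (fun z : ℝ × ℝ => Real.exp (-(t * z.1))) μ ∧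
      ∀ x : ℝ, k (mk2' t x) = ∫ z, ((Real.exp (-(z.1 * t)) : ℝ) : ℂ) * Complex.exp (((z.2 * x : ℝ) : ℂ) * Complex.I) ∂μ)
    (hap : μ {z : ℝ × ℝ | z.1 < 1 * |z.2|} = 0) {r : ℝ} (hr : 0 < r) {c₀ c₁ c₂ : ℂ}
    (h : ∀ φ : ℝ, k (polar r φ) = c₀ + c₁ * Complex.exp (3 * (φ : ℂ) * Complex.I) + c₂ * Complex.exp (-(3 * (φ : ℂ) * Complex.I))) :
    c₁ = 0 ∧ c₂ = 0 := by
  have hc12 : c₂ = -c₁ := by linear_combination coeff_add_eq_zero hT h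
  -- the angular function and the three-mode polynomial
  set H : ℂ → ℂ := fun z => ∫ w : ℝ × ℝ,
      Complex.exp (-((r : ℂ) * Complex.cos z * (w.1 : ℂ))) * Complex.exp ((r : ℂ) * Complex.sin z * (w.2 : ℂ) * Complex.I) ∂μ
    with hHdef
  set Q : ℂ → ℂ := fun z => c₀ + c₁ * Complex.exp (3 * z * Complex.I) + c₂ * Complex.exp (-(3 * z * Complex.I)) with hQdef
  set S : Set ℂ := {z : ℂ | -(π / 2) < z.re ∧ z.re < π / 2} with hSdef
  have hSopen : IsOpen S :=
    (isOpen_lt continuous_const Complex.continuous_re).inter (isOpen_lt Complex.continuous_re continuous_const)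
  have hSconn : IsPreconnected S := isPreconnected_vstrip _ _
  have hHd : DifferentiableOn ℂ H S := differentiableOn_angular μ (fun t ht => (hLF t ht).1) hap hr
  have hQd : DifferentiableOn ℂ Q S := by
    have : Differentiable ℂ Q := by rw [hQdef]; fun_prop
    exact this.differentiableOn
  -- real angles: `H φ = k (polar r φ) = Q φ`
  have hreal : ∀ t : ℝ, (t : ℂ) ∈ S → H t = Q t := by
    intro t ht
    have ht' : -(π / 2) < t ∧ t < π / 2 := by simpa [hSdef] using ht
    have hcos : 0 < Real.cos t := Real.cos_pos_of_mem_Ioo ⟨ht'.1, ht'.2⟩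
    have hpos : 0 < r * Real.cos t := mul_pos hr hcos
    have hH : H t = k (mk2' (r * Real.cos t) (r * Real.sin t)) := by
      rw [(hLF _ hpos).2 (r * Real.sin t)]
      simp only [hHdef]
      refine integral_congr_ae (Eventually.of_forall fun w => ?_)
      dsimp only
      rw [angularKer_ofReal, mul_comm w.1, mul_comm w.2]
    rw [hH]
    exact h t
  have hEq : EqOn H Q S := eqOn_of_eq_on_real hSopen hSconn hHd hQd (x₀ := 0) (by simp [hSdef, Real.pi_pos]) hreal
  -- imaginary angles: `H (iσ)` is a nonnegative real
  have himag : ∀ σ : ℝ, c₀ + c₁ * (((Real.exp (-(3 * σ)) : ℝ) : ℂ) - ((Real.exp (3 * σ) : ℝ) : ℂ))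
      = ((∫ w : ℝ × ℝ, Real.exp (-(r * (Real.cosh σ * w.1 + Real.sinh σ * w.2))) ∂μ : ℝ) : ℂ) := by
    intro σ
    have hmem : ((σ : ℂ) * Complex.I) ∈ S := by simp [hSdef, Real.pi_pos]
    have hval := hEq hmem
    simp only [hHdef, hQdef] at hval
    rw [(exp_three_mul_imag σ).1, (exp_three_mul_imag σ).2, hc12] at hval
    have hint : (∫ w : ℝ × ℝ, Complex.exp (-((r : ℂ) * Complex.cos ((σ : ℂ) * Complex.I) * (w.1 : ℂ))) *
        Complex.exp ((r : ℂ) * Complex.sin ((σ : ℂ) * Complex.I) * (w.2 : ℂ) * Complex.I) ∂μ)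
        = ((∫ w : ℝ × ℝ, Real.exp (-(r * (Real.cosh σ * w.1 + Real.sinh σ * w.2))) ∂μ : ℝ) : ℂ) := by
      rw [← integral_complex_ofReal]
      refine integral_congr_ae (Eventually.of_forall fun w => ?_)
      exact angularKer_imag r σ w.1 w.2
    rw [hint] at hval
    linear_combination -hval
  have hc1 : c₁ = 0 :=
    coeff_eq_zero_of_nonneg c₀ c₁ (fun σ => ∫ w : ℝ × ℝ, Real.exp (-(r * (Real.cosh σ * w.1 + Real.sinh σ * w.2))) ∂μ)
      (fun σ => integral_nonneg fun w => (Real.exp_pos _).le) himag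
  exact ⟨hc1, by rw [hc12, hc1, neg_zero]⟩

/-- **R4 «BOOST-POSITIVITY KILL», UNFOLDED.**  For `k : ℝ² → ℂ` invariant under `θ₂`, represented on `{t > 0}` by a complex planar
Laplace–Fourier measure `μ` (`e^{−tE} ∈ L¹(μ)`, `k(t,x) = ∫ e^{−tE}e^{ixp}dμ`) of aperture `1`, whose every circle trace is a three-mode
trigonometric polynomial `c₀ + c₁e^{3iφ} + c₂e^{−3iφ}`: `k` is invariant under every linear isometry off `0` — the conclusion of
`BoostPositivityKill`, character for character.  (The remaining hypotheses of `InHermitianPlanarClass` are not needed.) [folklore] -/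
theorem boostPositivityKill_unfolded (k : E2 → ℂ) (μ : Measure (ℝ × ℝ))
    (hT : ∀ y, k (timeReflection 2 y) = k y)
    (hLF : ∀ t : ℝ, 0 < t → Integrable (fun z : ℝ × ℝ => Real.exp (-(t * z.1))) μ ∧
      ∀ x : ℝ, k (mk2' t x) = ∫ z, ((Real.exp (-(z.1 * t)) : ℝ) : ℂ) * Complex.exp (((z.2 * x : ℝ) : ℂ) * Complex.I) ∂μ)
    (hap : μ {z : ℝ × ℝ | z.1 < 1 * |z.2|} = 0)
    (h3 : ∀ r : ℝ, 0 < r → ∃ c₀ c₁ c₂ : ℂ, ∀ φ : ℝ,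
      k (polar r φ) = c₀ + c₁ * Complex.exp (3 * (φ : ℂ) * Complex.I) + c₂ * Complex.exp (-(3 * (φ : ℂ) * Complex.I))) :
    ∀ (R : E2 ≃ₗᵢ[ℝ] E2) (y : E2), y ≠ 0 → k (R y) = k y := by
  intro R y hy
  have hr : 0 < ‖y‖ := norm_pos_iff.mpr hy
  have hRy : R y ≠ 0 := fun h0 => hy (by simpa using congrArg R.symm h0)
  obtain ⟨c₀, c₁, c₂, hc⟩ := h3 ‖y‖ hr
  obtain ⟨hc1, hc2⟩ := threeMode_coeff_eq_zero k μ hT hLF hap hr hc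
  have hrad : ∀ φ : ℝ, k (polar ‖y‖ φ) = c₀ := fun φ => by
    rw [hc φ, hc1, hc2, zero_mul, zero_mul, add_zero, add_zero]
  obtain ⟨φ, hφ⟩ := exists_polar hy
  obtain ⟨φ', hφ'⟩ := exists_polar hRy
  rw [LinearIsometryEquiv.norm_map] at hφ'
  calc k (R y) = k (polar ‖y‖ φ') := by rw [← hφ']
    _ = c₀ := hrad φ'
    _ = k (polar ‖y‖ φ) := (hrad φ).symm
    _ = k y := by rw [← hφ]

end Summit.QuantumFields.YangMills.Theorems.F4SubCurvatureDoorHermitianBoost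

end
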